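import Mathlib
import HarnessLib
import HarnessLib.Audit
import Summits.AtomisticToContinuum.Statement

/-!
Route: LargeDimensionLadder

CLOSED (retired) 2026-08-15T13:43:50Z by operator:999:1257524 — reason: not-a-thesis: assembly does not conclude the sub-problem Statement — note: D-0027 §2.1 audit (human 2026-08-15: routes that do not decide the summit are removed): the assembly concludes `Literature.MathematicalPhysics.KineticTheory.HydrodynamicLimit`, not the sub-problem statement; a NEW conforming route may be opened from the same idea (generated `closes : … → _root_.Hydr. The file is kept as the record of this route; refuted decls are indexed as negative knowledge (`ledger negatives`).

# Route LargeDimensionLadder — Let the dimension do the mixing — one d-uniform local-equilibrium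
engine for the packing-guarded fixed-density Euler limit on T^d, proved from the top rung d ≥ d₀
down to d = 3

It suffices to show X = AllDimensionEuler (card large-dimension-ladder, spine): for EVERY dimension
d ≥ 3 the packing-guarded
fixed-density Euler limit holds on 𝕋^d — N+1 deterministic hard spheres of diameter σ(N+1)^(-1/d),
(N+1)ε^d = σ^d fixed (no Boltzmann–Grad),
local Gibbs data, classical d-dimensional hard-sphere Euler solution (E = ρ(|u|²/2 + dθ/2), p =
ρθZ_d(ρσ^d)) with local packing ρ_tσ^d < η₀(d),
LLN of the fields at t = 0 ⇒ LLN at every t < T. Its d = 3 member is the packing-guarded conjunct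
HydroLimitInBand (stmt 3093, route
ImplosionLoophole), which with DiluteSelfConsistency (stmt 3091) gives HydrodynamicLimit. The LINE
is a ladder in the hidden parameter d at
fixed reduced density η = ρσ^d: prove X first on the top rungs d ≥ d₀ (crux HighDimensionEuler),
where high-dimensional geometry supplies
three suppressions at once — strangers (non-local recollisions per collision ≍ K_d^-(d-1), K_d = ℓ/ε
= 1/(V_(d-1)η) superexponentially large),
gentle kicks (mean-square deflection ≤ π²/d, support GrazingDeflectionMoment: the tagged velocity is
an Ornstein–Uhlenbeck-like sum of many
small fresh kicks, the structure behind the physicists' exact d = ∞ liquid dynamics), short memory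
(tails t^(-d/2), ring logarithms only at
order η^(d-1)) — by ONE d-uniform engine, LocalEquilibriumAllDim (1-marginal → local Maxwellian of
the Euler solution, 2-marginal
factorises, RELATIVE to the local hard-sphere Gibbs state), whose constants are explicit in (d, η)
and are then followed down to d = 3, where
smallness comes from η alone (the conjunct's own σ < σ₀). Honest caveat (audit design point 1): at
fixed η the top rung is dilute in the
kinetic sense (ε/ℓ = V_(d-1)η → 0 superexponentially, Z − 1 ≍ V_dη/2), so the descent d → 3 IS the
dilute → dense step relabelled; what the
d-axis adds over the σ-axis is the grazing/CLT structure and the weaker memory, not a new density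
regime.
Lean: `∀ d : ℕ, 3 ≤ d → ∃ η₀ : ℝ, 0 < η₀ ∧ ∀ (a₀ θ₀ : UnitAddTorus (Fin d) → ℝ) (u₀ : UnitAddTorus
(Fin d) → EuclideanSpace ℝ (Fin d)), Continuous a₀ → Continuous θ₀ → Continuous u₀ → (∀ x, 0 < a₀ x)
→ (∀ x, 0 < θ₀ x) → ∃ σ₀ : ℝ, 0 < σ₀ ∧ ∀ σ : ℝ, 0 < σ → σ < σ₀ → let G :=
Literature.Analysis.FluidPDE.Torus.geometry (Fin d); let ε := fun N : ℕ => σ * ((N + 1 : ℕ) : ℝ) ^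
(-(1 / (d : ℝ))); let f₀ := fun y : UnitAddTorus (Fin d) × EuclideanSpace ℝ (Fin d) => a₀ y.1 *
Literature.Analysis.FluidPDE.localMaxwellian 1 (θ₀ y.1) (u₀ y.1) y.2; ∀ (T : ℝ) (ρ θ : ℝ →
UnitAddTorus (Fin d) → ℝ) (u : ℝ → UnitAddTorus (Fin d) → EuclideanSpace ℝ (Fin d)), let Z := fun η
: ℝ => 1 + η * deriv (fun η' : ℝ => limsup (fun n : ℕ => -(n : ℝ)⁻¹ * Real.log (volume {q : Fin n →
UnitAddTorus (Fin d) | ∀ i j, i ≠ j → (η' / n) ^ (1 / (d : ℝ)) <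
Literature.Analysis.FluidPDE.Torus.euclidDist (q i) (q j)}).toReal) atTop) η; let P := fun r ϑ : ℝ
=> r * ϑ * Z (r * σ ^ d); let E := fun (r : ℝ) (w : EuclideanSpace ℝ (Fin d)) (ϑ : ℝ) => r * (‖w‖ ^
2 / 2 + (d : ℝ) / 2 * ϑ); Literature.Analysis.FunctionSpaces.Torus.IsSmoothSpaceTimeOn (Ico 0 T) ρ →
Literature.Analysis.FunctionSpaces.Torus.IsSmoothSpaceTimeOn (Ico 0 T) u →
Literature.Analysis.FunctionSpaces.Torus.IsSmoothSpaceTimeOn (Ico 0 T) θ → (∀ t ∈ Ico 0 T, ∀ x, 0 <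
ρ t x) → (∀ t ∈ Ico 0 T, ∀ x, 0 < θ t x) → (∀ t ∈ Ico 0 T, ∀ x,
Literature.Analysis.FunctionSpaces.Torus.timeDerivWithin (Ico 0 T) ρ t x +
Literature.Analysis.FunctionSpaces.Torus.divergence (fun y => ρ t y • u t y) x = 0) → (∀ t ∈ Ico 0
T, ∀ x, Literature.Analysis.FunctionSpaces.Torus.timeDerivWithin (Ico 0 T) (fun s y => ρ s y • u s
y) t x + (∑ i, Literature.Analysis.FunctionSpaces.Torus.partialDeriv i (fun y => (ρ t y * u t y i) •
u t y) x) + Literature.Analysis.FunctionSpaces.Torus.gradient (fun y => P (ρ t y) (θ t y)) x = 0) →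
(∀ t ∈ Ico 0 T, ∀ x, Literature.Analysis.FunctionSpaces.Torus.timeDerivWithin (Ico 0 T) (fun s y =>
E (ρ s y) (u s y) (θ s y)) t x + Literature.Analysis.FunctionSpaces.Torus.divergence (fun y => (E (ρ
t y) (u t y) (θ t y) + P (ρ t y) (θ t y)) • u t y) x = 0) → (∀ t ∈ Ico 0 T, ∀ x, ρ t x * σ ^ d < η₀)
→ ∀ Φ : (N : ℕ) → Literature.Analysis.FluidPDE.HardSphereFlow G (ε N) (N + 1), let L := fun N : ℕ =>
Literature.Analysis.FluidPDE.particleLaw (Φ N) (Literature.Analysis.FluidPDE.canonicalDensity G (ε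
N) (N + 1) f₀); let Tend := fun t : ℝ => ∀ χ : UnitAddTorus (Fin d) → ℝ, Continuous χ → ∀ δ > (0 :
ℝ), Tendsto (fun N => L N {z | δ < |(∫ y, χ y.1 ∂Literature.Analysis.FluidPDE.empiricalMeasure ((Φ
N).flow t z)) - ∫ x, χ x * ρ t x|}) atTop (nhds 0) ∧ Tendsto (fun N => L N {z | δ < ‖(∫ y, χ y.1 •
y.2 ∂Literature.Analysis.FluidPDE.empiricalMeasure ((Φ N).flow t z)) - ∫ x, (χ x * ρ t x) • u t x‖})
atTop (nhds 0) ∧ Tendsto (fun N => L N {z | δ < |(∫ y, χ y.1 * (‖y.2‖ ^ 2 / 2)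
∂Literature.Analysis.FluidPDE.empiricalMeasure ((Φ N).flow t z)) - ∫ x, χ x * E (ρ t x) (u t x) (θ t
x)|}) atTop (nhds 0); Tend 0 → ∀ t ∈ Ico 0 T, Tend t`

## Assembly
Proved sorry-free in the planner's Sketch.lean (theorem assembly_holds): LocalEquilibriumAllDim ∧
MarginalsToFieldsAllDim ∧ FlowRelabelSymmetry
give AllDimensionEuler (allDim_of_engine: bookkeeping + slice continuity of smooth space–time
fields, IsSmoothSpaceTimeOn.isSmooth_slice /
IsSmooth.continuous); its d = 3 member feeds DimThreeGlue to give HydroLimitInBand (3093); with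
DiluteSelfConsistency (3091) the conjunct follows by
taking σ₀ = min of the two thresholds (tail_bookkeeping, the ImplosionLoophole assembly 3098). Only
the d = 3 members are consumed formally — the
∀ d form of the engine and the rung HighDimensionEuler encode the proof STRATEGY (top rung first,
explicit constants, descent), not extra logical
strength; this is stated, not hidden.

Rationale: WHY THIS LINE. Mechanism: in dimension d at fixed η every collision partner is a stranger and every
collision is a whisper — the Stosszahlansatz relative to
local equilibrium becomes a law of large numbers over many small, conditionally fresh kicks, and the
creation rate of dynamical correlations
(recollisions, ≍ K_d^-(d-1) per collision for long loops, ≍ 1/K_d for local three-body encounters)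
is superexponentially smaller in d than
their destruction rate (≍ 1/d per collision, momentum relaxation in ≍ d grazing collisions):
Cohen1967 §2 (dimension count of ring phase space;
van Leeuwen–Weijland l = s rule recorded in
Literature.Barriers.AtomisticToContinuum.NoDensityExpansionBarrier), ElskensFrisch1988 (kinetic
theory of hard spheres as d → ∞), MaimbourgKurchanZamponi2016 and AgoritsasMaimbourgZamponi2019
(exact d = ∞ liquid dynamics = O(d) weak kicks
from distinct neighbours; non-rigorous DMFT), WylerRivierFrisch1987 / FrischPercus1999 (statics:
virial series superexponentially convergent at
fixed η), BoblylevPulvirentiSaffirio2012 (particles → Landau consistency in the grazing regime —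
here the grazing law is supplied by
concentration of measure, not by scaling the potential). Imported areas: high-dimensional convex
geometry / concentration of measure (rim law of
the impact parameter, cap measures) and the physics of d = ∞ liquids, pointed at the rigorous
kinetic programme (Lanford1975, GST2013,
BGSSAnnals2023, PulvirentiSimonella2016, DengHaniMa2024). What it does that the board does not:
DenseKineticExpansion attacks the d = 3 cumulant
expansion (0804) head-on with no small parameter beyond σ; this route supplies a continuous axis on
which the same engine has a superexponentially
small parameter and a theorem-shaped top rung (HighDimensionEuler), typed d-generically so that its
d = 3 member is literally the guarded conjunct;
the retired companion hilbert-six-in-log-dimensions (fixed SECOND-VIRIAL density, refuted: ℓ/ε → 0,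
squeeze recollisions polynomial) is
avoided because here ℓ/ε = K_d → ∞. Negatives index empty at filing.

RANKED CRUXES. #0 AllDimensionEuler (target) — X: for every d ≥ 3 there is η₀(d) > 0 such that for
all continuous positive profiles on 𝕋^d there is σ₀ with: for σ < σ₀, every classical d-dimensional
hard-sphere Euler solution on [0,T) with packing ρ_tσ^d < η₀ and every family of hard-sphere flows,
LLN of the empirical density/momentum/energy fields under the local Gibbs law at t = 0 implies LLN
at every t < T (d-generic packing-guarded conjunct, inlined; d = 3 member = HydroLimitInBand 3093
via DimThreeGlue). Follows from LocalEquilibriumAllDim + MarginalsToFieldsAllDim +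
FlowRelabelSymmetry (theorem allDim_of_engine in the planner's Sketch.lean). (why it might fail:
Contains the guarded d = 3 conjunct; and d-uniformity may fail the other way: for d = 3,4 the
engine's constant C_d(η₀) < 1 may force η₀(d) far below any physically dilute density, i.e. the
ladder may not reach the ground.) [Spohn1991, OllaVaradhanYau1993, Cohen1967, ElskensFrisch1988]
#2 HighDimensionEuler (crux) — TOP RUNG (card R2): there is d₀ such that for every d ≥ d₀ the
packing-guarded fixed-density Euler limit holds on 𝕋^d (same inlined statement as the target, ∃ d₀ ∀
d ≥ d₀). The rung where all three suppressions (strangers K_d^-(d-1), gentle kicks π²/d, memory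
t^(-d/2)) are available; the informative first theorem of the ladder and the calibration point for
the d = 3 engine (DenseKineticExpansion 0804). [difficulty: open-problem] (why it might fail: Even
at d ≫ 1 each sphere makes ≍ N^(1/d)·V_(d-1)η√d/σ → ∞ collisions per unit time: decorrelation over
unbounded collision sequences is unproved in ANY d (Lanford radius ≈ 0.2 mft is combinatorial,
d-independent); MKZ's d = ∞ dynamics is physics-level and dense (φ̂ = O(1)).) [Lanford1975, GST2013,
BGSSAnnals2023, MaimbourgKurchanZamponi2016, AgoritsasMaimbourgZamponi2019, ElskensFrisch1988,
Spohn1991]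
#3 LocalEquilibriumAllDim (crux) — THE d-UNIFORM ENGINE (card D2 DressedContraction, typed shadow; d
= 3 member = packing-guarded form of DenseKineticExpansion's FixedFractionCumulantExpansion 0804):
for every d ≥ 3 there is η₀(d) > 0 such that for all profiles ∃ σ₀ ∀ σ < σ₀, every guarded classical
d-dim hs-Euler solution, every flow family with LLN at t = 0, and every t < T: the 1-particle
marginal of the time-t density W_N(t) = 1_D · (canonical local Gibbs density ∘ Φ_(-t)) converges in
(1+|v|²)²-weighted L¹ to ρ_t(x)M_(1,u_t(x),θ_t(x))(v) and the 2-particle marginal minus the product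
of 1-marginals tends to 0 in (1+|v|²)(1+|v′|²)-weighted L¹. Intended proof: cumulants relative to
the local hard-sphere Gibbs state, propagated by collision-dressed (mean-free-path damped)
propagators, contract uniformly on Euler times because creation (rate r_d·ν) loses to destruction
(rate ν/d); constants explicit in (d, η), superexponentially good in d, (πη)²-type at d = 3.
[difficulty: open-problem] (why it might fail: At d = 3 it is the fixed-density Boltzmann property
relative to local Gibbs over ≍N^(1/3) collision times (Spohn1991 I.3: no proof); hydrodynamic
(conserved-mode) pair correlations are not damped by collisions and ring resummation completeness is
unproved (Cohen1967 §4c-d) — uniformly in d.) [Cohen1967, Spohn1991, PulvirentiSimonella2016,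
BGSSAnnals2023, DengHaniMa2024, arXiv:2503.01800, ElskensFrisch1988]
#9 MarginalsToFieldsAllDim (support) — d-generic MARGINALS ⇒ FIELDS (Sznitman-type variance
computation + Chebyshev, the d-dim twin of DenseKineticExpansion's MarginalsToL2 0806 pushed to the
in-probability form): for d ≥ 3, σ > 0, continuous profiles, continuous (ρ_t,u_t,θ_t) with θ_t > 0,
flows Φ and t: if the time-t density W_N(t) is a.e. permutation-symmetric for every N, its
1-marginal → ρ_tM_(u_t,θ_t) in (1+|v|²)²-weighted L¹ and its 2-marginal − product → 0 in weighted
L¹, then the empirical density/momentum/energy fields at time t converge in probability to (ρ_t,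
ρ_tu_t, ρ_t(|u_t|²/2 + dθ_t/2)) tested against every continuous χ. [difficulty: provable-now]
[Sznitman1991, GST2013, Spohn1991]
#9 FlowRelabelSymmetry (support) — RELABELLING SYMMETRY: for d ≥ 3, σ > 0, profiles, any family of
hard-sphere flows, t, N and any permutation π of the N+1 labels, the time-t density 1_D·(canonical
local Gibbs density ∘ Φ_N(−t)) is a.e. invariant under z ↦ z∘π (canonical density and hard-sphere
domain are symmetric; a relabelled hard-sphere trajectory is a hard-sphere trajectory, so by
IsHardSphereTrajectory.unique_holds / HardSphereFlow.flow_eq_ae_holds the flow commutes with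
relabelling off a null set). Discharges the symmetry hypothesis of MarginalsToFieldsAllDim for every
HardSphereFlow (the structure carries no equivariance field). [difficulty: provable-now] [GST2013,
Alexander1975, CIP1994]
#9 GrazingDeflectionMoment (support) — GENTLE KICKS (mechanism (ii), elementary): under the
hard-sphere cross-section law in dimension d (impact parameter b uniform on the unit (d−1)-ball,
deflection angle of the relative velocity χ = 2 arccos|b|) the mean-square deflection is at most
π²/d: ∫_(|b|<1) (2 arccos|b|)² db ≤ (π²/d)·vol(B^(d−1)) for every d ≥ 2 (proof: 4 arccos² r ≤
π²(1−r) on [0,1] by concavity, and E[1−|b|] = 1/d under the rim law (d−1)r^(d−2)dr; numerically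
LHS/vol ≈ 8/d). Records the quantitative grazing dominance used by the engine at the top rung.
[difficulty: provable-now] [ElskensFrisch1988, AgoritsasMaimbourgZamponi2019, CIP1994]
#9 DimThreeGlue (support) — d = 3 SPECIALISATION: the d = 3 member of the inlined d-generic guarded
statement (UnitAddTorus (Fin 3), exponent 1/↑3, energy ρ(|u|²/2 + ↑3/2·θ), pressure ρθ(1 + η
f_ex′(η)) from the d = 3 free volume) implies HydroLimitInBand exactly as typed in route
ImplosionLoophole (stmt 3093: library hsDiameter, localGibbsLaw, IsHardSphereEulerSolution,
TendstoHydroFieldsAt, totalEnergyDensity, hsPressure). Pure unfolding plus Nat.cast bookkeeping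
((3:ℕ):ℝ) = 3 (the three defining identities are checked by `simp` in the planner's Sketch.lean).
[difficulty: provable-now] [Spohn1991,
Literature.MathematicalPhysics.KineticTheory.HydrodynamicLimit (HardSphereEuler.lean)]
#9 DiluteSelfConsistency (support) — SHARED with route ImplosionLoophole (stmt 3091, a crux there;
filed here by identical signature as the tail of the assembly): for every η > 0 and all profiles
there is σ₀ such that for σ < σ₀ every admissible classical hard-sphere Euler solution (t = 0 fields
= LLN limit of the local Gibbs laws) keeps packing ρ_tσ³ < η on [0,T). Not staffed by this route; if
its negation DenseExcursion (3090) is proved, this route re-targets to HydroLimitInBand like every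
guarded route. [difficulty: open-problem] [Sideris1985, Spohn1991,
route-AtomisticToContinuum-ImplosionLoophole]

TWO-LAYER PLAN. Foreseen glued splits (nothing filed now). HighDimensionEuler ⇐
HighDimLocalEquilibrium (∃ d₀ ∀ d ≥ d₀ form of the engine) → [MarginalsToFieldsAllDim,
FlowRelabelSymmetry] → HighDimensionEuler (k = 1 + glue; the glue is allDim_of_engine restricted to
d ≥ d₀). HighDimLocalEquilibrium ⇐
FreshPartnerStatistics (card D1: under the evolved law, non-local recollisions per collision ≤
C^d(V_(d−1)η)^(d−1), local three-body encounters ≤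
C·V_(d−1)η, and successive scattering directions conditionally C(V_(d−1)η + d(V_(d−1)η)^(d−1))-close
in total variation to independent draws from
the cross-section law — filed informally at open, rank 4) → GrazingKickRelaxation (OU/Landau-type
relaxation of the tagged velocity in ≍ d
collisions, the CLT over fresh grazing kicks; BoblylevPulvirentiSaffirio2012, doi:10.1002/cpa.70035
for the linearised Landau long-time technology)
→ DressedContraction_d (cumulant hierarchy relative to local Gibbs with collision-dressed
propagators contracts for d ≥ d₀) → HighDimLocalEquilibrium
(k = 3). Card R1 (DimensionAsymptoticEuler: accuracy δ*(d) → 0 at fixed η via finite equilibrium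
windows τ₀ ≍ r_d^-1, conditional on the long-time
equilibrium fluctuation technology of iterated-limit-euler-finite-windows — audit design point 2)
becomes a child of HighDimensionEuler once a
d-uniform profile class (C^k bounds Λ on data AND solution) is fixed; it is not typed now because d₀
must depend on Λ. LocalEquilibriumAllDim at
d = 3 ⇐ the DenseKineticExpansion children of 0804 with the constant read as a creation/destruction
ratio (attacked last).

KILL CRITERIA. Refutation of HighDimensionEuler (e.g. a d-uniform obstruction: an O(1)
non-hydrodynamic memory of the tagged sphere or O(1) long-range dynamical
pair correlations on Euler times for every d, or failure of the fixed-density LLN in some high d)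
removes the top of the ladder — close
`refuted:HighDimensionEuler`. Refutation of LocalEquilibriumAllDim through its d = 3 member while
HighDimensionEuler stands turns the route into an
analogue programme with no path to the conjunct — close `superseded` in favour of whichever d = 3
route survives, keeping the rung as a Literature
target. DenseExcursion (3090) proved ⇒ DiluteSelfConsistency refuted ⇒ the tail breaks for every
guarded route: restate the assembly to end at
HydroLimitInBand per the operator's ruling (tenure `--restate`), not a close. HydroLimitInBand or
L2HydroFields proved by any other route moots the
d = 3 payoff (close `superseded`; rungs survive as analogue theorems). A computation showing any of
the three suppressions is only POLYNOMIAL in d at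
fixed η (as happened at fixed second-virial density) retires the rationale — pivot or close
`refuted:HighDimensionEuler` after refuter evidence.

NOT DECOMPOSED YET. The cumulant/cluster vocabulary relative to local Gibbs (shared need with
DenseKineticExpansion 0804) and hence the dressed-contraction form of the
engine; the recollision bookkeeping along HardSphereFlow trajectories (contactSet-based recollision
counts) needed to type FreshPartnerStatistics;
the d-uniform profile class for R1; the explicit functions η₀(d), d₀, C_d(η); velocity-tail control
in d dimensions (HighMomentumCutoff analogue,
eased by concentration of |v|²/d — routed to card apriori-tails-and-rattlers at d = 3); the
Enskog-contact correction carrying Z_d − 1 ≍ V_dη/2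
(superexponentially small but nonzero at the top rung). All are layer-2 children after
HighDimensionEuler or LocalEquilibriumAllDim moves.

CHEAPEST FALSIFIER. One page of arithmetic (redo independently; see Numbers): at FIXED η = ρσ^d, (a)
K_d = ℓ/ε = 1/(V_(d−1)η) → ∞ superexponentially (top
rung kinetically dilute — conceded); (b) P(second collision within the collision duration t_c) ≍
t_c/t_mft = 1/K_d per collision (the local
'squeeze' events that killed hilbert-six-in-log-dimensions at fixed second-virial density, where ℓ/ε
→ 0; here superexponentially rare);
(c) non-local recollisions cost aiming factors ∫ K_d^-(d−1) τ^-(d−1) dτ, ≍ K_d^-(d−1) beyond one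
mean free time; (d) E[χ²] ≤ π²/d
(GrazingDeflectionMoment; numerically ≈ 8/d). If (b) or (c) is only polynomial in d at fixed η, or
if the LLN hypothesis at t = 0 were
unsatisfiable in high d (vacuous rung — it is not: partition functions positive for σ small, statics
superexponentially ideal,
WylerRivierFrisch1987), the line dies. Second cheapest: does ElskensFrisch1988 or the DMFT
literature exhibit a d-uniform NON-hydrodynamic memory
term at fixed η (they sit at φ̂ = 2^dφ/d = O(1), far denser; at fixed η I expect none)?

NUMBERS. K_3 = 1/(πη) (ε/ℓ = πη at d = 3, ℓ = 1/(Nπε²), Nε³ = η); K_d = 1/(V_(d−1)η), V_(d−1) =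
π^((d−1)/2)/Γ((d+1)/2) ≍ (2πe/d)^(d/2): at η = 0.1,
K_3 ≈ 3.2, K_6 ≈ 1.9, K_10 ≈ 3.9, K_20 ≈ 1.7·10³, K_30 ≈ 4.6·10⁶ (the suppression only bites beyond
d ≈ 12 at this η — d₀ is not small).
Mean-square deflection ≤ π²/d (≈ 8.0/d asymptotically; 2.93 at d = 3, 0.41 at d = 20). Collisions
per particle per unit macroscopic time ≍
N^(1/d)·V_(d−1)η·⟨|v_rel|⟩/σ → ∞ in every d (Kn = K_d σ N^(-1/d)). Z_d(η) − 1 = V_dη/2 + O((V_dη)²)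
(second virial 2^(d−1)v_d in packing units;
WylerRivierFrisch1987). Ring logarithm first at the (d+1)-body term, order η^(d−1) log η (Cohen1967
§4d for d = 3: n² log n from the four-body
term; van Leeuwen–Weijland φ_s^l ∼ ln z at l = s). Lanford validity time ≈ 0.2 mean free times in
every d (GST2013). Items at open: 9 typed (+1
informal crux filed after open).

DEFINITION REQUESTS. (1) `HydrodynamicLimitDim (d : ℕ) (σ : ℝ) : Prop` and its packing-guarded
variant in Literature/MathematicalPhysics/KineticTheory (card D4): the
d-generic twins of hsFreeVolume/hsExcessFreeEnergy/hsCompressibility/hsPressure (exponent 1/d),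
totalEnergyDensity (dθ/2), IsHardSphereEulerSolution,
hsDiameter, localGibbsLaw, empirical fields, TendstoHydroFieldsAt, HydrodynamicLimitFor — so that
the 3–4 kB inlined items of this route can be
restated compactly (`ledger workitem add --kind definition --notion HydrodynamicLimitDim …` filed
after open, --for AllDimensionEuler).
(2) Cumulants of the time-t law relative to the local hard-sphere Gibbs state (shared with
DenseKineticExpansion 0804) and recollision counts along
HardSphereFlow trajectories (contactSet-based) — deferred until a crux moves.

Novelty: Searches (2026-08-15; local searchd down, OpenAlex/S2/arXiv HTTP 429, Crossref and galaxy live):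
`lit frontier AtomisticToContinuum --since 2020`
(30 rows; relevant: doi:10.1002/cpa.70035 long-time linearised Boltzmann/Landau from particles,
arXiv:2602.04407 Bourbaki on Deng–Hani–Ma; nothing
dimension-indexed); `lit search --source crossref "hard spheres infinite dimensions kinetic theory
dynamics"` (8: ElskensFrisch1988 =
doi:10.1103/physreva.37.4351, ParisiUrbaniZamponi2019 chapters doi:10.1017/9781108120494.003/.004);
`… "Lanford theorem validity Boltzmann equation
arbitrary dimension"` (8, none on d-dependence); `… "dynamical mean field theory hard spheres large
dimension liquids"` (8, electronic DMFT only);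
`… "hydrodynamic limit hard sphere gas high dimensional"` (8, none); `lit galaxy search "spheres in
infinite dimensions" --star all` (8: Altieri
thesis, Biroli–Urbani arXiv:1704.04649, Spigler thesis — glass/jamming physics); `lit galaxy search
"hard spheres in high dimensions dynamics
kinetic theory" --star all` (0); plus the card's own sweep (crossref ×6, arXiv ×2, all 27 cards then
on the board) and its audit (refuter 6-0:
"rigorous use of d → ∞ for hard-sphere DYNAMICS: none found"; added AgoritsasMaimbourgZamponi2019,
Manacorda–Schehr–Zamponi 2020, Charbonneau et
al. MD to d ≈ 13). Board: 7 route files read (none dimension-indexed); retired companions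
hilbert-six-in-log-dimensions (refuted) and
sigma-asymptotic-euler (superseded) read and steered around.
Nearest  [refs: 10.1002/cpa.70035, 10.1103/physreva.37.4351, 10.1017/9781108120494.003/.004, 10.1103/physreva.37.4351:, 2602.04407, 1704.04649, 2503.01800, doi:10.1002/cpa.70035, doi:10.1103/physreva.37.4351, doi:10.1017/9781108120494.003/.004, ElskensFrisch1988, ParisiUrbaniZamponi2019, AgoritsasMaimbourgZamponi2019, MaimbourgKurchanZamponi2016, BoblylevPulvirentiSaffirio2012, Lanford1975, GST2013, BGSSAnnals202]

Barriers (technique_class: toy-ladder high-dimension dynamical-cumulant-hierarchy): - technique_class: toy-ladder high-dimension dynamical-cumulant-hierarchy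
- Literature.Barriers.AtomisticToContinuum.NoDensityExpansionBarrier: applies to
LocalEquilibriumAllDim (a dynamical cumulant expansion). Evasion as in the barrier's own sources
(Cohen1967 §4a–b): cumulants RELATIVE to local Gibbs, collision-dressed (mean-free-path cut-off)
propagators, no term-by-term free-streaming expansion; and at the top rung the first logarithm sits
at order η^(d−1) (van Leeuwen–Weijland l = s rule), below any accuracy used. At d = 3 the barrier is
not evaded, only quantified (ring order (πη)², η small) — conceded; kill criterion names it.
- Literature.Barriers.AtomisticToContinuum.DiluteRegimeBarrier: in letter not met ((N+1)ε^d = σ^d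
fixed in every rung, EOS = Z_d, no Boltzmann–Grad sequence). In spirit PARTLY met and said so: at
fixed η the top rung has ε/ℓ = V_(d−1)η superexponentially small and Z − 1 superexponentially small,
so the d-descent is the dilute → dense interpolation relabelled; the bet is that the descent is
quantitative (explicit C_d(η)) inside ONE typed family, which the σ-axis (iterated limits) does not
offer, and that the particle → Enskog-type step the barrier's scope caveat (4) names as the real
open problem is exactly LocalEquilibriumAllDim.
- Literature.Barriers.AtomisticToContinuum.BoltzmannHypothesisBarrier: no entropy method and no
classification of stationary states is used (scope (d): the barrier obstructs closures THROUGH the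
infinite-volume classifi

History (route lifecycle, newest last):
- 2026-08-15T13:43:50Z · CLOSED retired — not-a-thesis: assembly does not conclude the sub-problem Statement (operator:999:1257524)

sub-problem: HydrodynamicLimit · status: closed(retired) · opened planner-plancard-AtomisticToContinuum-Hydrody-8e92f730-0 2026-08-15T11:45:10Z · rev 0 · ledger route-AtomisticToContinuum-LargeDimensionLadder
GENERATED by the gate from the ledger (D-0016/17). Provers cite these decls: `theorem foo : Summit.AtomisticToContinuum.HydrodynamicLimit.Theses.LargeDimensionLadder.<Decl> := …` in Summits/AtomisticToContinuum/HydrodynamicLimit/Theorems/<Name>.lean.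
-/

namespace Summit.AtomisticToContinuum.HydrodynamicLimit.Theses.LargeDimensionLadder

open scoped BigOperators Topology Manifold Classical MeasureTheory ProbabilityTheory Matrix InnerProductSpace ComplexConjugate ContinuousMap
open Filter Set Function TopologicalSpace MeasureTheory

attribute [summit_statement] _root_.HydrodynamicLimit

/-- item stmt-AtomisticToContinuum-6226 · target · rank 0 · closed · moot by None · by planner
why it might fail: Contains the guarded d = 3 conjunct; and d-uniformity may fail the other way: for d = 3,4 the engine's constant C_d(η₀) < 1 may force η₀(d) far below any physically dilute density, i.e. the ladder may not reach the ground.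
sources: Spohn1991, OllaVaradhanYau1993, Cohen1967, ElskensFrisch1988
[target] X: for every d ≥ 3 there is η₀(d) > 0 such that for all continuous positive profiles on 𝕋^d
there is σ₀ with: for σ < σ₀, every classical d-dimensional hard-sphere Euler solution on [0,T) with
packing ρ_tσ^d < η₀ and every family of hard-sphere flows, LLN of the empirical
density/momentum/energy fields under the local Gibbs law at t = 0 implies LLN at every t < T
(d-generic packing-guarded conjunct, inlined; d = 3 member = HydroLimitInBand 3093 via
DimThreeGlue). Follows from LocalEquilibriumAllDim + MarginalsToFieldsAllDim + FlowRelabelSymmetry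
(theorem allDim_of_engine in the planner's Sketch.lean). -/
@[route_item "route-AtomisticToContinuum-LargeDimensionLadder"]
def AllDimensionEuler : Prop :=
  ∀ d : ℕ, 3 ≤ d → ∃ η₀ : ℝ, 0 < η₀ ∧ ∀ (a₀ θ₀ : UnitAddTorus (Fin d) → ℝ) (u₀ : UnitAddTorus (Fin d) → EuclideanSpace ℝ (Fin d)), Continuous a₀ → Continuous θ₀ → Continuous u₀ → (∀ x, 0 < a₀ x) → (∀ x, 0 < θ₀ x) → ∃ σ₀ : ℝ, 0 < σ₀ ∧ ∀ σ : ℝ, 0 < σ → σ < σ₀ → let G := Literature.Analysis.FluidPDE.Torus.geometry (Fin d); let ε := fun N : ℕ => σ * ((N + 1 : ℕ) : ℝ) ^ (-(1 / (d : ℝ))); let f₀ := fun y : UnitAddTorus (Fin d) × EuclideanSpace ℝ (Fin d) => a₀ y.1 * Literature.Analysis.FluidPDE.localMaxwellian 1 (θ₀ y.1) (u₀ y.1) y.2; ∀ (T : ℝ) (ρ θ : ℝ → UnitAddTorus (Fin d) → ℝ) (u : ℝ → UnitAddTorus (Fin d) → EuclideanSpace ℝ (Fin d)), let Z := fun η :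 ℝ => 1 + η * deriv (fun η' : ℝ => limsup (fun n : ℕ => -(n : ℝ)⁻¹ * Real.log (volume {q : Fin n → UnitAddTorus (Fin d) | ∀ i j, i ≠ j → (η' / n) ^ (1 / (d : ℝ)) < Literature.Analysis.FluidPDE.Torus.euclidDist (q i) (q j)}).toReal) atTop) η; let P := fun r ϑ : ℝ => r * ϑ * Z (r * σ ^ d); let E := fun (r : ℝ) (w : EuclideanSpace ℝ (Fin d)) (ϑ : ℝ) => r * (‖w‖ ^ 2 / 2 + (d : ℝ) / 2 * ϑ); Literature.Analysis.FunctionSpaces.Torus.IsSmoothSpaceTimeOn (Ico 0 T) ρ → Literature.Analysis.FunctionSpaces.Torus.IsSmoothSpaceTimeOn (Ico 0 T) u → Literature.Analysis.FunctionSpaces.Torus.IsSmoothSpaceTimeOn (Ico 0 T) θ → (∀ t ∈ Ico 0 T, ∀ x, 0 < ρ t x) → (∀ t ∈ Ico 0 T, ∀ x, 0 < θ t x) → (∀ t ∈ Ico 0 T, ∀ x, Literature.Analysis.FunctionSpaces.Torus.timeDerivWithin (Ico 0 T) ρ t x + Literature.Analysis.FunctionSpaces.Torus.divergence (fun y =>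 ρ t y • u t y) x = 0) → (∀ t ∈ Ico 0 T, ∀ x, Literature.Analysis.FunctionSpaces.Torus.timeDerivWithin (Ico 0 T) (fun s y => ρ s y • u s y) t x + (∑ i, Literature.Analysis.FunctionSpaces.Torus.partialDeriv i (fun y => (ρ t y * u t y i) • u t y) x) + Literature.Analysis.FunctionSpaces.Torus.gradient (fun y => P (ρ t y) (θ t y)) x = 0) → (∀ t ∈ Ico 0 T, ∀ x, Literature.Analysis.FunctionSpaces.Torus.timeDerivWithin (Ico 0 T) (fun s y => E (ρ s y) (u s y) (θ s y)) t x + Literature.Analysis.FunctionSpaces.Torus.divergence (fun y => (E (ρ t y) (u t y) (θ t y) + P (ρ t y) (θ t y)) • u t y) x = 0) → (∀ t ∈ Ico 0 T, ∀ x, ρ t x * σ ^ d < η₀) → ∀ Φ : (N : ℕ) → Literature.Analysis.FluidPDE.HardSphereFlow G (ε N) (N + 1), let L := fun N : ℕ => Literature.Analysis.FluidPDE.particleLaw (Φ N) (Literature.Analysis.FluidPDE.canonicalDensity G (ε N) (N + 1) f₀); let Tend := fun t : ℝ => ∀ χ : UnitAddTorus (Fin d) → ℝ, Continuous χ → ∀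 δ > (0 : ℝ), Tendsto (fun N => L N {z | δ < |(∫ y, χ y.1 ∂Literature.Analysis.FluidPDE.empiricalMeasure ((Φ N).flow t z)) - ∫ x, χ x * ρ t x|}) atTop (nhds 0) ∧ Tendsto (fun N => L N {z | δ < ‖(∫ y, χ y.1 • y.2 ∂Literature.Analysis.FluidPDE.empiricalMeasure ((Φ N).flow t z)) - ∫ x, (χ x * ρ t x) • u t x‖}) atTop (nhds 0) ∧ Tendsto (fun N => L N {z | δ < |(∫ y, χ y.1 * (‖y.2‖ ^ 2 / 2) ∂Literature.Analysis.FluidPDE.empiricalMeasure ((Φ N).flow t z)) - ∫ x, χ x * E (ρ t x) (u t x) (θ t x)|}) atTop (nhds 0); Tend 0 → ∀ t ∈ Ico 0 T, Tend t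

/-- item stmt-AtomisticToContinuum-6227 · crux · rank 2 · closed · moot by None · by planner
why it might fail: Even at d ≫ 1 each sphere makes ≍ N^(1/d)·V_(d-1)η√d/σ → ∞ collisions per unit time: decorrelation over unbounded collision sequences is unproved in ANY d (Lanford radius ≈ 0.2 mft is combinatorial, d-independent); MKZ's d = ∞ dynamics is physics-level and dense (φ̂ = O(1)).
sources: Lanford1975, GST2013, BGSSAnnals2023, MaimbourgKurchanZamponi2016, AgoritsasMaimbourgZamponi2019, ElskensFrisch1988
[crux] TOP RUNG (card R2): there is d₀ such that for every d ≥ d₀ the packing-guarded fixed-density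
Euler limit holds on 𝕋^d (same inlined statement as the target, ∃ d₀ ∀ d ≥ d₀). The rung where all
three suppressions (strangers K_d^-(d-1), gentle kicks π²/d, memory t^(-d/2)) are available; the
informative first theorem of the ladder and the calibration point for the d = 3 engine
(DenseKineticExpansion 0804). [difficulty: open-problem] -/
@[route_item "route-AtomisticToContinuum-LargeDimensionLadder"]
def HighDimensionEuler : Prop :=
  ∃ d₀ : ℕ, ∀ d : ℕ, d₀ ≤ d → ∃ η₀ : ℝ, 0 < η₀ ∧ ∀ (a₀ θ₀ : UnitAddTorus (Fin d) → ℝ) (u₀ : UnitAddTorus (Fin d) → EuclideanSpace ℝ (Fin d)), Continuous a₀ → Continuous θ₀ → Continuous u₀ → (∀ x, 0 < a₀ x) → (∀ x, 0 < θ₀ x) → ∃ σ₀ : ℝ, 0 < σ₀ ∧ ∀ σ : ℝ, 0 < σ → σ < σ₀ → let G := Literature.Analysis.FluidPDE.Torus.geometry (Fin d); let ε := fun N : ℕ => σ * ((N + 1 : ℕ) : ℝ) ^ (-(1 / (d : ℝ))); let f₀ := fun y : UnitAddTorus (Fin d) × EuclideanSpace ℝ (Fin d) => a₀ y.1 * Literature.Analysis.FluidPDE.localMaxwellian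 1 (θ₀ y.1) (u₀ y.1) y.2; ∀ (T : ℝ) (ρ θ : ℝ → UnitAddTorus (Fin d) → ℝ) (u : ℝ → UnitAddTorus (Fin d) → EuclideanSpace ℝ (Fin d)), let Z := fun η : ℝ => 1 + η * deriv (fun η' : ℝ => limsup (fun n : ℕ => -(n : ℝ)⁻¹ * Real.log (volume {q : Fin n → UnitAddTorus (Fin d) | ∀ i j, i ≠ j → (η' / n) ^ (1 / (d : ℝ)) < Literature.Analysis.FluidPDE.Torus.euclidDist (q i) (q j)}).toReal) atTop) η; let P := fun r ϑ : ℝ => r * ϑ * Z (r * σ ^ d); let E := fun (r : ℝ) (w : EuclideanSpace ℝ (Fin d)) (ϑ : ℝ) => r * (‖w‖ ^ 2 / 2 + (d : ℝ) / 2 * ϑ); Literature.Analysis.FunctionSpaces.Torus.IsSmoothSpaceTimeOn (Ico 0 T) ρ → Literature.Analysis.FunctionSpaces.Torus.IsSmoothSpaceTimeOn (Ico 0 T) u → Literature.Analysis.FunctionSpaces.Torus.IsSmoothSpaceTimeOn (Ico 0 T) θ → (∀ t ∈ Ico 0 T, ∀ x, 0 < ρ t x) → (∀ t ∈ Ico 0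 T, ∀ x, 0 < θ t x) → (∀ t ∈ Ico 0 T, ∀ x, Literature.Analysis.FunctionSpaces.Torus.timeDerivWithin (Ico 0 T) ρ t x + Literature.Analysis.FunctionSpaces.Torus.divergence (fun y => ρ t y • u t y) x = 0) → (∀ t ∈ Ico 0 T, ∀ x, Literature.Analysis.FunctionSpaces.Torus.timeDerivWithin (Ico 0 T) (fun s y => ρ s y • u s y) t x + (∑ i, Literature.Analysis.FunctionSpaces.Torus.partialDeriv i (fun y => (ρ t y * u t y i) • u t y) x) + Literature.Analysis.FunctionSpaces.Torus.gradient (fun y => P (ρ t y) (θ t y)) x = 0) → (∀ t ∈ Ico 0 T, ∀ x, Literature.Analysis.FunctionSpaces.Torus.timeDerivWithin (Ico 0 T) (fun s y => E (ρ s y) (u s y) (θ s y)) t x + Literature.Analysis.FunctionSpaces.Torus.divergence (fun y => (E (ρ t y) (u t y) (θ t y) + P (ρ t y) (θ t y)) • u t y) x = 0) → (∀ t ∈ Ico 0 T, ∀ x, ρ t x * σ ^ d < η₀) → ∀ Φ : (N : ℕ) → Literature.Analysis.FluidPDE.HardSphereFlow G (ε N) (N + 1), let L := fun N : ℕ =>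 Literature.Analysis.FluidPDE.particleLaw (Φ N) (Literature.Analysis.FluidPDE.canonicalDensity G (ε N) (N + 1) f₀); let Tend := fun t : ℝ => ∀ χ : UnitAddTorus (Fin d) → ℝ, Continuous χ → ∀ δ > (0 : ℝ), Tendsto (fun N => L N {z | δ < |(∫ y, χ y.1 ∂Literature.Analysis.FluidPDE.empiricalMeasure ((Φ N).flow t z)) - ∫ x, χ x * ρ t x|}) atTop (nhds 0) ∧ Tendsto (fun N => L N {z | δ < ‖(∫ y, χ y.1 • y.2 ∂Literature.Analysis.FluidPDE.empiricalMeasure ((Φ N).flow t z)) - ∫ x, (χ x * ρ t x) • u t x‖}) atTop (nhds 0) ∧ Tendsto (fun N => L N {z | δ < |(∫ y, χ y.1 * (‖y.2‖ ^ 2 / 2) ∂Literature.Analysis.FluidPDE.empiricalMeasure ((Φ N).flow t z)) - ∫ x, χ x * E (ρ t x) (u t x) (θ t x)|}) atTop (nhds 0); Tend 0 → ∀ t ∈ Ico 0 T, Tend t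

/-- item stmt-AtomisticToContinuum-6228 · crux · rank 3 · closed · moot by None · by planner
why it might fail: At d = 3 it is the fixed-density Boltzmann property relative to local Gibbs over ≍N^(1/3) collision times (Spohn1991 I.3: no proof); hydrodynamic (conserved-mode) pair correlations are not damped by collisions and ring resummation completeness is unproved (Cohen1967 §4c-d) — uniformly in d.
sources: Cohen1967, Spohn1991, PulvirentiSimonella2016, BGSSAnnals2023, DengHaniMa2024, arXiv:2503.01800
[crux] THE d-UNIFORM ENGINE (card D2 DressedContraction, typed shadow; d = 3 member =
packing-guarded form of DenseKineticExpansion's FixedFractionCumulantExpansion 0804): for every d ≥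
3 there is η₀(d) > 0 such that for all profiles ∃ σ₀ ∀ σ < σ₀, every guarded classical d-dim
hs-Euler solution, every flow family with LLN at t = 0, and every t < T: the 1-particle marginal of
the time-t density W_N(t) = 1_D · (canonical local Gibbs density ∘ Φ_(-t)) converges in
(1+|v|²)²-weighted L¹ to ρ_t(x)M_(1,u_t(x),θ_t(x))(v) and the 2-particle marginal minus the product
of 1-marginals tends to 0 in (1+|v|²)(1+|v′|²)-weighted L¹. Intended proof: cumulants relative to
the local hard-sphere Gibbs state, propagated by collision-dressed (mean-free-path damped)
propagators, contract uniformly on Euler times because creation (rate r_d·ν) loses to destruction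
(rate ν/d); constants explicit in (d, η), superexponentially good in d, (πη)²-type at d = 3.
[difficulty: open-problem] -/
@[route_item "route-AtomisticToContinuum-LargeDimensionLadder"]
def LocalEquilibriumAllDim : Prop :=
  ∀ d : ℕ, 3 ≤ d → ∃ η₀ : ℝ, 0 < η₀ ∧ ∀ (a₀ θ₀ : UnitAddTorus (Fin d) → ℝ) (u₀ : UnitAddTorus (Fin d) → EuclideanSpace ℝ (Fin d)), Continuous a₀ → Continuous θ₀ → Continuous u₀ → (∀ x, 0 < a₀ x) → (∀ x, 0 < θ₀ x) → ∃ σ₀ : ℝ, 0 < σ₀ ∧ ∀ σ : ℝ, 0 < σ → σ < σ₀ → let G := Literature.Analysis.FluidPDE.Torus.geometry (Fin d); let ε := fun N : ℕ => σ * ((N + 1 : ℕ) : ℝ) ^ (-(1 / (d : ℝ))); let f₀ := fun y : UnitAddTorus (Fin d) × EuclideanSpace ℝ (Fin d) => a₀ y.1 * Literature.Analysis.FluidPDE.localMaxwellian 1 (θ₀ y.1) (u₀ y.1) y.2; ∀ (T : ℝ) (ρ θ : ℝ → UnitAddTorus (Fin d) → ℝ) (u : ℝ → UnitAddTorus (Fin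 d) → EuclideanSpace ℝ (Fin d)), let Z := fun η : ℝ => 1 + η * deriv (fun η' : ℝ => limsup (fun n : ℕ => -(n : ℝ)⁻¹ * Real.log (volume {q : Fin n → UnitAddTorus (Fin d) | ∀ i j, i ≠ j → (η' / n) ^ (1 / (d : ℝ)) < Literature.Analysis.FluidPDE.Torus.euclidDist (q i) (q j)}).toReal) atTop) η; let P := fun r ϑ : ℝ => r * ϑ * Z (r * σ ^ d); let E := fun (r : ℝ) (w : EuclideanSpace ℝ (Fin d)) (ϑ : ℝ) => r * (‖w‖ ^ 2 / 2 + (d : ℝ) / 2 * ϑ); Literature.Analysis.FunctionSpaces.Torus.IsSmoothSpaceTimeOn (Ico 0 T) ρ → Literature.Analysis.FunctionSpaces.Torus.IsSmoothSpaceTimeOn (Ico 0 T) u → Literature.Analysis.FunctionSpaces.Torus.IsSmoothSpaceTimeOn (Ico 0 T) θ → (∀ t ∈ Ico 0 T, ∀ x, 0 < ρ t x) → (∀ t ∈ Ico 0 T, ∀ x, 0 < θ t x) → (∀ t ∈ Ico 0 T, ∀ x, Literature.Analysis.FunctionSpaces.Torus.timeDerivWithin (Ico 0 T) ρ t x + Literature.Analysis.FunctionSpaces.Torus.divergence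 (fun y => ρ t y • u t y) x = 0) → (∀ t ∈ Ico 0 T, ∀ x, Literature.Analysis.FunctionSpaces.Torus.timeDerivWithin (Ico 0 T) (fun s y => ρ s y • u s y) t x + (∑ i, Literature.Analysis.FunctionSpaces.Torus.partialDeriv i (fun y => (ρ t y * u t y i) • u t y) x) + Literature.Analysis.FunctionSpaces.Torus.gradient (fun y => P (ρ t y) (θ t y)) x = 0) → (∀ t ∈ Ico 0 T, ∀ x, Literature.Analysis.FunctionSpaces.Torus.timeDerivWithin (Ico 0 T) (fun s y => E (ρ s y) (u s y) (θ s y)) t x + Literature.Analysis.FunctionSpaces.Torus.divergence (fun y => (E (ρ t y) (u t y) (θ t y) + P (ρ t y) (θ t y)) • u t y) x = 0) → (∀ t ∈ Ico 0 T, ∀ x, ρ t x * σ ^ d < η₀) → ∀ Φ : (N : ℕ) → Literature.Analysis.FluidPDE.HardSphereFlow G (ε N) (N + 1), let L := fun N : ℕ => Literature.Analysis.FluidPDE.particleLaw (Φ N) (Literature.Analysis.FluidPDE.canonicalDensity G (ε N) (N + 1) f₀); let Tend := fun t : ℝ => ∀ χ : UnitAddTorus (Fin d) → ℝ, Continuous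 χ → ∀ δ > (0 : ℝ), Tendsto (fun N => L N {z | δ < |(∫ y, χ y.1 ∂Literature.Analysis.FluidPDE.empiricalMeasure ((Φ N).flow t z)) - ∫ x, χ x * ρ t x|}) atTop (nhds 0) ∧ Tendsto (fun N => L N {z | δ < ‖(∫ y, χ y.1 • y.2 ∂Literature.Analysis.FluidPDE.empiricalMeasure ((Φ N).flow t z)) - ∫ x, (χ x * ρ t x) • u t x‖}) atTop (nhds 0) ∧ Tendsto (fun N => L N {z | δ < |(∫ y, χ y.1 * (‖y.2‖ ^ 2 / 2) ∂Literature.Analysis.FluidPDE.empiricalMeasure ((Φ N).flow t z)) - ∫ x, χ x * E (ρ t x) (u t x) (θ t x)|}) atTop (nhds 0); Tend 0 → ∀ t ∈ Ico 0 T, let W := fun N : ℕ => (Literature.Analysis.FluidPDE.hardSphereDomain G (N + 1) (ε N)).indicator (Literature.Analysis.FluidPDE.hsTransport (Φ N) t (Literature.Analysis.FluidPDE.canonicalDensity G (ε N) (N + 1) f₀)); let g := fun y : UnitAddTorus (Fin d) × EuclideanSpace ℝ (Fin d) => ρ t y.1 * Literature.Analysis.FluidPDE.localMaxwellian 1 (θ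 t y.1) (u t y.1) y.2; Tendsto (fun N : ℕ => ∫⁻ y : UnitAddTorus (Fin d) × EuclideanSpace ℝ (Fin d), ENNReal.ofReal ((1 + ‖y.2‖ ^ 2) ^ 2 * |Literature.Analysis.FluidPDE.nthMarginal (N + 1) 1 (W N) (fun _ => y) - g y|)) atTop (nhds 0) ∧ Tendsto (fun N : ℕ => ∫⁻ p : (UnitAddTorus (Fin d) × EuclideanSpace ℝ (Fin d)) × (UnitAddTorus (Fin d) × EuclideanSpace ℝ (Fin d)), ENNReal.ofReal ((1 + ‖p.1.2‖ ^ 2) * (1 + ‖p.2.2‖ ^ 2) * |Literature.Analysis.FluidPDE.nthMarginal (N + 1) 2 (W N) ![p.1, p.2] - Literature.Analysis.FluidPDE.nthMarginal (N + 1) 1 (W N) ![p.1] * Literature.Analysis.FluidPDE.nthMarginal (N + 1) 1 (W N) ![p.2]|)) atTop (nhds 0)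

-- item stmt-AtomisticToContinuum-7282 · crux · rank 4 · closed · moot by None · by planner — informal only, no Lean statement yet:
--   [crux] FRESH PARTNERS AND GENTLE KICKS (card D1; informal until recollision bookkeeping along
--   HardSphereFlow trajectories is typed): for d ≥ d₀ and reduced density η = ρσ^d below η₀(d),
--   uniformly in N and in t on Euler times [0,T₁], under the law evolved from local Gibbs data (first:
--   under the EQUILIBRIUM hard-sphere measure on 𝕋^d, where it is a statement about a stationary
--   process): (a) NON-LOCAL recollisions are superexponentially rare — the probability that a tagged
--   sphere collides again with a former partner within s mean free times, other than within a fixed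
--   multiple of the collision dur

/-- item stmt-AtomisticToContinuum-6229 · support · rank 9 · closed · moot by None · by planner
sources: Sznitman1991, GST2013, Spohn1991
[support] d-generic MARGINALS ⇒ FIELDS (Sznitman-type variance computation + Chebyshev, the d-dim
twin of DenseKineticExpansion's MarginalsToL2 0806 pushed to the in-probability form): for d ≥ 3, σ
> 0, continuous profiles, continuous (ρ_t,u_t,θ_t) with θ_t > 0, flows Φ and t: if the time-t
density W_N(t) is a.e. permutation-symmetric for every N, its 1-marginal → ρ_tM_(u_t,θ_t) in
(1+|v|²)²-weighted L¹ and its 2-marginal − product → 0 in weighted L¹, then the empirical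
density/momentum/energy fields at time t converge in probability to (ρ_t, ρ_tu_t, ρ_t(|u_t|²/2 +
dθ_t/2)) tested against every continuous χ. [difficulty: provable-now] -/
@[route_item "route-AtomisticToContinuum-LargeDimensionLadder"]
def MarginalsToFieldsAllDim : Prop :=
  ∀ d : ℕ, 3 ≤ d → ∀ (σ : ℝ) (a₀ θ₀ : UnitAddTorus (Fin d) → ℝ) (u₀ : UnitAddTorus (Fin d) → EuclideanSpace ℝ (Fin d)), let G := Literature.Analysis.FluidPDE.Torus.geometry (Fin d); let ε := fun N : ℕ => σ * ((N + 1 : ℕ) : ℝ) ^ (-(1 / (d : ℝ))); let f₀ := fun y : UnitAddTorus (Fin d) × EuclideanSpace ℝ (Fin d) => a₀ y.1 * Literature.Analysis.FluidPDE.localMaxwellian 1 (θ₀ y.1) (u₀ y.1) y.2; ∀ (ρ θ : ℝ → UnitAddTorus (Fin d) → ℝ) (u : ℝ → UnitAddTorus (Fin d) → EuclideanSpace ℝ (Fin d)) (Φ : (N : ℕ) → Literature.Analysis.FluidPDE.HardSphereFlow G (ε N) (N + 1)) (t : ℝ), 0 < σ → Continuous a₀ → Continuous θ₀ → Continuous u₀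 → (∀ x, 0 < a₀ x) → (∀ x, 0 < θ₀ x) → Continuous (ρ t) → Continuous (u t) → Continuous (θ t) → (∀ x, 0 < θ t x) → let E := fun (r : ℝ) (w : EuclideanSpace ℝ (Fin d)) (ϑ : ℝ) => r * (‖w‖ ^ 2 / 2 + (d : ℝ) / 2 * ϑ); let L := fun N : ℕ => Literature.Analysis.FluidPDE.particleLaw (Φ N) (Literature.Analysis.FluidPDE.canonicalDensity G (ε N) (N + 1) f₀); let W := fun N : ℕ => (Literature.Analysis.FluidPDE.hardSphereDomain G (N + 1) (ε N)).indicator (Literature.Analysis.FluidPDE.hsTransport (Φ N) t (Literature.Analysis.FluidPDE.canonicalDensity G (ε N) (N + 1) f₀)); let g := fun y : UnitAddTorus (Fin d) × EuclideanSpace ℝ (Fin d) => ρ t y.1 * Literature.Analysis.FluidPDE.localMaxwellian 1 (θ t y.1) (u t y.1) y.2; (∀ (N : ℕ) (π : Equiv.Perm (Fin (N + 1))), EventuallyEq (ae volume) (fun z => W N (z ∘ π)) (W N)) → Tendsto (fun N : ℕ => ∫⁻ y : UnitAddTorus (Fin d) × EuclideanSpace ℝ (Fin d), ENNReal.ofReal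 ((1 + ‖y.2‖ ^ 2) ^ 2 * |Literature.Analysis.FluidPDE.nthMarginal (N + 1) 1 (W N) (fun _ => y) - g y|)) atTop (nhds 0) → Tendsto (fun N : ℕ => ∫⁻ p : (UnitAddTorus (Fin d) × EuclideanSpace ℝ (Fin d)) × (UnitAddTorus (Fin d) × EuclideanSpace ℝ (Fin d)), ENNReal.ofReal ((1 + ‖p.1.2‖ ^ 2) * (1 + ‖p.2.2‖ ^ 2) * |Literature.Analysis.FluidPDE.nthMarginal (N + 1) 2 (W N) ![p.1, p.2] - Literature.Analysis.FluidPDE.nthMarginal (N + 1) 1 (W N) ![p.1] * Literature.Analysis.FluidPDE.nthMarginal (N + 1) 1 (W N) ![p.2]|)) atTop (nhds 0) → ∀ χ : UnitAddTorus (Fin d) → ℝ, Continuous χ → ∀ δ > (0 : ℝ), Tendsto (fun N => L N {z | δ < |(∫ y, χ y.1 ∂Literature.Analysis.FluidPDE.empiricalMeasure ((Φ N).flow t z)) - ∫ x, χ x * ρ t x|}) atTop (nhds 0) ∧ Tendsto (fun N => L N {z | δ < ‖(∫ y, χ y.1 • y.2 ∂Literature.Analysis.FluidPDE.empiricalMeasure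 ((Φ N).flow t z)) - ∫ x, (χ x * ρ t x) • u t x‖}) atTop (nhds 0) ∧ Tendsto (fun N => L N {z | δ < |(∫ y, χ y.1 * (‖y.2‖ ^ 2 / 2) ∂Literature.Analysis.FluidPDE.empiricalMeasure ((Φ N).flow t z)) - ∫ x, χ x * E (ρ t x) (u t x) (θ t x)|}) atTop (nhds 0)

/-- item stmt-AtomisticToContinuum-6230 · support · rank 9 · closed · moot by None · by planner
sources: GST2013, Alexander1975, CIP1994
[support] RELABELLING SYMMETRY: for d ≥ 3, σ > 0, profiles, any family of hard-sphere flows, t, N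
and any permutation π of the N+1 labels, the time-t density 1_D·(canonical local Gibbs density ∘
Φ_N(−t)) is a.e. invariant under z ↦ z∘π (canonical density and hard-sphere domain are symmetric; a
relabelled hard-sphere trajectory is a hard-sphere trajectory, so by
IsHardSphereTrajectory.unique_holds / HardSphereFlow.flow_eq_ae_holds the flow commutes with
relabelling off a null set). Discharges the symmetry hypothesis of MarginalsToFieldsAllDim for every
HardSphereFlow (the structure carries no equivariance field). [difficulty: provable-now] -/
@[route_item "route-AtomisticToContinuum-LargeDimensionLadder"]
def FlowRelabelSymmetry : Prop :=
  ∀ d : ℕ, 3 ≤ d → ∀ (σ : ℝ) (a₀ θ₀ : UnitAddTorus (Fin d) → ℝ) (u₀ : UnitAddTorus (Fin d) → EuclideanSpace ℝ (Fin d)), let G := Literature.Analysis.FluidPDE.Torus.geometry (Fin d); let ε := fun N : ℕ => σ * ((N + 1 : ℕ) : ℝ) ^ (-(1 / (d : ℝ))); let f₀ := fun y : UnitAddTorus (Fin d) × EuclideanSpace ℝ (Fin d) => a₀ y.1 * Literature.Analysis.FluidPDE.localMaxwellian 1 (θ₀ y.1) (u₀ y.1) y.2; ∀ (Φ : (N :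 ℕ) → Literature.Analysis.FluidPDE.HardSphereFlow G (ε N) (N + 1)) (t : ℝ) (N : ℕ) (π : Equiv.Perm (Fin (N + 1))), 0 < σ → EventuallyEq (ae volume) (fun z => (Literature.Analysis.FluidPDE.hardSphereDomain G (N + 1) (ε N)).indicator (Literature.Analysis.FluidPDE.hsTransport (Φ N) t (Literature.Analysis.FluidPDE.canonicalDensity G (ε N) (N + 1) f₀)) (z ∘ π)) ((Literature.Analysis.FluidPDE.hardSphereDomain G (N + 1) (ε N)).indicator (Literature.Analysis.FluidPDE.hsTransport (Φ N) t (Literature.Analysis.FluidPDE.canonicalDensity G (ε N) (N + 1) f₀)))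

/-- item stmt-AtomisticToContinuum-6231 · support · rank 9 · closed · moot by None · by planner
sources: ElskensFrisch1988, AgoritsasMaimbourgZamponi2019, CIP1994
[support] GENTLE KICKS (mechanism (ii), elementary): under the hard-sphere cross-section law in
dimension d (impact parameter b uniform on the unit (d−1)-ball, deflection angle of the relative
velocity χ = 2 arccos|b|) the mean-square deflection is at most π²/d: ∫_(|b|<1) (2 arccos|b|)² db ≤
(π²/d)·vol(B^(d−1)) for every d ≥ 2 (proof: 4 arccos² r ≤ π²(1−r) on [0,1] by concavity, and
E[1−|b|] = 1/d under the rim law (d−1)r^(d−2)dr; numerically LHS/vol ≈ 8/d). Records the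
quantitative grazing dominance used by the engine at the top rung. [difficulty: provable-now] -/
@[route_item "route-AtomisticToContinuum-LargeDimensionLadder"]
def GrazingDeflectionMoment : Prop :=
  ∀ d : ℕ, 2 ≤ d → ∫ b in Metric.ball (0 : EuclideanSpace ℝ (Fin (d - 1))) 1, (2 * Real.arccos ‖b‖) ^ 2 ≤ Real.pi ^ 2 / d * (volume (Metric.ball (0 : EuclideanSpace ℝ (Fin (d - 1))) 1)).toReal

/-- item stmt-AtomisticToContinuum-6232 · support · rank 9 · closed · moot by None · by planner
sources: Spohn1991, Literature.MathematicalPhysics.KineticTheory.HydrodynamicLimit (HardSphereEuler.lean)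
[support] d = 3 SPECIALISATION: the d = 3 member of the inlined d-generic guarded statement
(UnitAddTorus (Fin 3), exponent 1/↑3, energy ρ(|u|²/2 + ↑3/2·θ), pressure ρθ(1 + η f_ex′(η)) from
the d = 3 free volume) implies HydroLimitInBand exactly as typed in route ImplosionLoophole (stmt
3093: library hsDiameter, localGibbsLaw, IsHardSphereEulerSolution, TendstoHydroFieldsAt,
totalEnergyDensity, hsPressure). Pure unfolding plus Nat.cast bookkeeping ((3:ℕ):ℝ) = 3 (the three
defining identities are checked by `simp` in the planner's Sketch.lean). [difficulty: provable-now] -/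
@[route_item "route-AtomisticToContinuum-LargeDimensionLadder"]
def DimThreeGlue : Prop :=
  (∃ η₀ : ℝ, 0 < η₀ ∧ ∀ (a₀ θ₀ : UnitAddTorus (Fin 3) → ℝ) (u₀ : UnitAddTorus (Fin 3) → EuclideanSpace ℝ (Fin 3)), Continuous a₀ → Continuous θ₀ → Continuous u₀ → (∀ x, 0 < a₀ x) → (∀ x, 0 < θ₀ x) → ∃ σ₀ : ℝ, 0 < σ₀ ∧ ∀ σ : ℝ, 0 < σ → σ < σ₀ → let G := Literature.Analysis.FluidPDE.Torus.geometry (Fin 3); let ε := fun N : ℕ => σ * ((N + 1 : ℕ) : ℝ) ^ (-(1 / ((3 : ℕ) : ℝ))); let f₀ := fun y : UnitAddTorus (Fin 3) × EuclideanSpace ℝ (Fin 3) => a₀ y.1 * Literature.Analysis.FluidPDE.localMaxwellian 1 (θ₀ y.1) (u₀ y.1) y.2; ∀ (T : ℝ) (ρ θ : ℝ → UnitAddTorus (Fin 3) → ℝ) (u : ℝ → UnitAddTorus (Fin 3) → EuclideanSpace ℝ (Fin 3)), let Z := fun η : ℝ => 1 + η * deriv (fun η' : ℝ => limsup (fun n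 : ℕ => -(n : ℝ)⁻¹ * Real.log (volume {q : Fin n → UnitAddTorus (Fin 3) | ∀ i j, i ≠ j → (η' / n) ^ (1 / ((3 : ℕ) : ℝ)) < Literature.Analysis.FluidPDE.Torus.euclidDist (q i) (q j)}).toReal) atTop) η; let P := fun r ϑ : ℝ => r * ϑ * Z (r * σ ^ 3); let E := fun (r : ℝ) (w : EuclideanSpace ℝ (Fin 3)) (ϑ : ℝ) => r * (‖w‖ ^ 2 / 2 + ((3 : ℕ) : ℝ) / 2 * ϑ); Literature.Analysis.FunctionSpaces.Torus.IsSmoothSpaceTimeOn (Ico 0 T) ρ → Literature.Analysis.FunctionSpaces.Torus.IsSmoothSpaceTimeOn (Ico 0 T) u → Literature.Analysis.FunctionSpaces.Torus.IsSmoothSpaceTimeOn (Ico 0 T) θ → (∀ t ∈ Ico 0 T, ∀ x, 0 < ρ t x) → (∀ t ∈ Ico 0 T, ∀ x, 0 < θ t x) → (∀ t ∈ Ico 0 T, ∀ x, Literature.Analysis.FunctionSpaces.Torus.timeDerivWithin (Ico 0 T) ρ t x + Literature.Analysis.FunctionSpaces.Torus.divergence (fun y => ρ t y • u t y) x = 0)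 → (∀ t ∈ Ico 0 T, ∀ x, Literature.Analysis.FunctionSpaces.Torus.timeDerivWithin (Ico 0 T) (fun s y => ρ s y • u s y) t x + (∑ i, Literature.Analysis.FunctionSpaces.Torus.partialDeriv i (fun y => (ρ t y * u t y i) • u t y) x) + Literature.Analysis.FunctionSpaces.Torus.gradient (fun y => P (ρ t y) (θ t y)) x = 0) → (∀ t ∈ Ico 0 T, ∀ x, Literature.Analysis.FunctionSpaces.Torus.timeDerivWithin (Ico 0 T) (fun s y => E (ρ s y) (u s y) (θ s y)) t x + Literature.Analysis.FunctionSpaces.Torus.divergence (fun y => (E (ρ t y) (u t y) (θ t y) + P (ρ t y) (θ t y)) • u t y) x = 0) → (∀ t ∈ Ico 0 T, ∀ x, ρ t x * σ ^ 3 < η₀) → ∀ Φ : (N : ℕ) → Literature.Analysis.FluidPDE.HardSphereFlow G (ε N) (N + 1), let L := fun N : ℕ => Literature.Analysis.FluidPDE.particleLaw (Φ N) (Literature.Analysis.FluidPDE.canonicalDensity G (ε N) (N + 1) f₀); let Tend := fun t : ℝ => ∀ χ : UnitAddTorus (Fin 3) → ℝ, Continuous χ → ∀ δ > (0 : ℝ),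 Tendsto (fun N => L N {z | δ < |(∫ y, χ y.1 ∂Literature.Analysis.FluidPDE.empiricalMeasure ((Φ N).flow t z)) - ∫ x, χ x * ρ t x|}) atTop (nhds 0) ∧ Tendsto (fun N => L N {z | δ < ‖(∫ y, χ y.1 • y.2 ∂Literature.Analysis.FluidPDE.empiricalMeasure ((Φ N).flow t z)) - ∫ x, (χ x * ρ t x) • u t x‖}) atTop (nhds 0) ∧ Tendsto (fun N => L N {z | δ < |(∫ y, χ y.1 * (‖y.2‖ ^ 2 / 2) ∂Literature.Analysis.FluidPDE.empiricalMeasure ((Φ N).flow t z)) - ∫ x, χ x * E (ρ t x) (u t x) (θ t x)|}) atTop (nhds 0); Tend 0 → ∀ t ∈ Ico 0 T, Tend t) → (∃ η₀ : ℝ, 0 < η₀ ∧ ∀ (a₀ θ₀ : UnitAddTorus (Fin 3) → ℝ) (u₀ : UnitAddTorus (Fin 3) → EuclideanSpace ℝ (Fin 3)), Continuous a₀ → Continuous θ₀ → Continuous u₀ → (∀ x, 0 < a₀ x) → (∀ x, 0 < θ₀ x) → ∃ σ₀ : ℝ, 0 < σ₀ ∧ ∀ σ : ℝ, 0 < σ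 → σ < σ₀ → ∀ (T : ℝ) (ρ θ : ℝ → UnitAddTorus (Fin 3) → ℝ) (u : ℝ → UnitAddTorus (Fin 3) → EuclideanSpace ℝ (Fin 3)), Literature.MathematicalPhysics.KineticTheory.IsHardSphereEulerSolution σ T ρ u θ → (∀ t ∈ Ico 0 T, ∀ x, ρ t x * σ ^ 3 < η₀) → ∀ Φ : (N : ℕ) → Literature.Analysis.FluidPDE.HardSphereFlow (Literature.Analysis.FluidPDE.Torus.geometry (Fin 3)) (Literature.MathematicalPhysics.KineticTheory.hsDiameter σ N) (N + 1), Literature.MathematicalPhysics.KineticTheory.TendstoHydroFieldsAt (fun N => Literature.MathematicalPhysics.KineticTheory.localGibbsLaw σ a₀ u₀ θ₀ N (Φ N)) Φ ρ u θ 0 → ∀ t ∈ Ico 0 T, Literature.MathematicalPhysics.KineticTheory.TendstoHydroFieldsAt (fun N => Literature.MathematicalPhysics.KineticTheory.localGibbsLaw σ a₀ u₀ θ₀ N (Φ N)) Φ ρ u θ t)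

-- TODO item stmt-AtomisticToContinuum-6233 · assembly · rank 1 · closed · moot by None · by planner — BLOCKED: missing decl(s) DiluteSelfConsistency; restate via `ledger route edit` once they land:
--   def Assembly : Prop := LocalEquilibriumAllDim → MarginalsToFieldsAllDim → FlowRelabelSymmetry → DimThreeGlue → DiluteSelfConsistency → Literature.MathematicalPhysics.KineticTheory.HydrodynamicLimit

end Summit.AtomisticToContinuum.HydrodynamicLimit.Theses.LargeDimensionLadder
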